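import Mathlib
import Summits.NavierStokesRegularity.NavierStokesRegularity.Theorems.RootDecompLitSliceEnergyClockScarLaw
import Summits.NavierStokesRegularity.NavierStokesRegularity.Theorems.CertifiedBlowupCertifiedBlowupAxisymBlowupEnergyDrain
import Literature.Analysis.FluidPDE.NSLerayBlowupRateEnstrophy
import Literature.Analysis.FluidPDE.NSCriticalClosureProofs
import Literature.Analysis.FluidPDE.TaoLocalisationHolds
import HarnessLib

/-!
# Route RootDecompLitSlice — LERAY FLOORS of the energy–clock plane at a first blow-up
  (helpers toward the cell Uᶜ `CritTameScarIsCritical`, stmt-NavierStokesRegularity-31733)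

Companion of `RootDecompLitSliceEnergyClockScarLaw.lean` (two-exponent law `α(a,b) = 2b/(1+b−a)`, the
½-Hölder sub-cell of Uᶜ is a theorem, Uᶜ ⟺ its energy-rough sub-cell). On the MAXIMAL-SMOOTH frame
(first blow-up at `T`, Leray–Hopf on `[0,T]`, rapidly decaying datum) Leray's enstrophy rate
`∫|∇u(t)|² ≥ cν^{3/2}(T−t)^{−1/2}` (tree: `leray_blowup_rate_enstrophy`, slab bound discharged by
`eLpNorm_uncurry_top_lt_top_of_tao2011 tao2011_hasBoundedSobolevNormsOn_holds`) and the landed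
energy-drop inequality `EnergyDrain.dissipation_le_energy_sub` FLOOR both exponents:

* `energyDrop_ge_leray` — ENERGY FLOOR: `‖u(t)‖₂² − ‖u(T)‖₂² ≥ c ν^{5/2} √(T−t)` for every
  `t ∈ [0,T)`, one universal `c > 0`; hence
* `no_energyLaw_above_half` — no energy law `‖u(t)‖₂² − ‖u(T)‖₂² ≤ C(T−t)^a` with `a > 1/2` holds
  near a first blow-up time: the energy exponent is CAPPED at `a = 1/2`, and the ½-Hölder sub-cell of
  Uᶜ (`halfHolderClockCell`) is the cell of LERAY-SHARP dissipation `‖u(t)‖₂² − ‖u(T)‖₂² ≍ √(T−t)`;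
* `clock_ge_leray` — CLOCK FLOOR: `∫|u(t)−u(T)|² ≥ c ν⁵ (T−t)/‖u₀‖₂²` (the `L²`-trajectory cannot
  reach `u(T)` faster than linearly); hence
* `no_clock_above_one` — no clock `∫|u(t)−u(T)|² ≤ K(T−t)^b` with `b > 1` at a first blow-up.

THE ENERGY–CLOCK RECTANGLE (by kernel, this file + the law file): at a first blow-up the exponent
pair lies in `b ∈ (0,1]`, `a ∈ [b/2, 1/2]`; the free-window trade-off closes exactly the region
`a + b ≥ 1`, which meets the rectangle only over the clocks `b ≥ 1/2` — never in the abrupt cell Uᵃ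
(`b < 1/2`, Tao's habitat), and at the critical clock `b = 1/2` (Uᶜ) only in the Leray-sharp corner
`a = 1/2`. Uᶜ's open content: `b = 1/2`, `a ∈ [1/4, 1/2)` (super-Leray dissipation bursts).

HONEST FRAMING: helper lemmas inside the Tao-vacuous cell Uᶜ; no item, no node, no load of the route
moves (ROOT ⟺ U ∧ P1, critic rows 354/371/563). Rung 0: nothing here proves NS regularity.
Decomp-ns route-writer g36. [folklore]
-/

set_option linter.dupNamespace false

namespace Summit.NavierStokesRegularity.NavierStokesRegularity.Theorems

open MeasureTheory Set
open scoped ENNReal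
open Literature.Analysis.FluidPDE

namespace EnergyClockScarLaw

/-- **Energy floor (Leray)**: at a first blow-up time `T` (maximal smooth solution, Leray–Hopf on
`[0,T]`, rapidly decaying datum), `c ν^{5/2} √(T−t) ≤ ‖u(t)‖₂² − ‖u(T)‖₂²` for all `t ∈ [0,T)`, with
one universal `c > 0`: Leray's enstrophy rate integrated over `(t,T)` (only the pointwise bound
`(T−s)^{−1/2} ≥ (T−t)^{−1/2}` is used) under the energy-drop inequality. [folklore] -/
theorem energyDrop_ge_leray :
    ∃ c : ℝ, 0 < c ∧ ∀ (ν T : ℝ), 0 < ν → 0 < T →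
    ∀ (u : ℝ → EuclideanSpace ℝ (Fin 3) → EuclideanSpace ℝ (Fin 3))
      (p : ℝ → EuclideanSpace ℝ (Fin 3) → ℝ),
      Literature.Analysis.FluidPDE.IsMaximalSmoothSolution ν 0 u p T →
      Literature.Analysis.FluidPDE.IsLerayHopfOn T ν 0 (u 0) u →
      Literature.Analysis.FluidPDE.HasRapidSpatialDecay (u 0) →
      ∀ t ∈ Set.Ico 0 T,
        c * ν ^ (5 / 2 : ℝ) * Real.sqrt (T - t) ≤ (∫ x, ‖u t x‖ ^ 2) - ∫ x, ‖u T x‖ ^ 2 := by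
  obtain ⟨c, hc, hL⟩ := leray_blowup_rate_enstrophy
  refine ⟨2 * c, by positivity, ?_⟩
  intro ν T hν hT u p hmax hLH hdec t ht
  have hcl : IsClassicalNSSolutionOn (Ico 0 T) ν 0 u p := hmax.1
  have hbd := eLpNorm_uncurry_top_lt_top_of_tao2011 tao2011_hasBoundedSobolevNormsOn_holds hν hcl
    hLH hdec
  have hfl := hL ν T hν hT u p hmax hLH hbd
  have hTt : 0 < T - t := sub_pos.mpr ht.2
  set F : ℝ → ℝ≥0∞ := fun s => ∫⁻ x, ENNReal.ofReal (frobeniusNormSq (fderiv ℝ (u s) x)) with hF_def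
  obtain ⟨hfin, hdis⟩ := CertifiedBlowupAxisymBlowup.EnergyDrain.dissipation_le_energy_sub hν hcl hLH
    (t₁ := t) (t₂ := T) ht.1 ht.2.le le_rfl
  -- the floor level `L = c ν^{3/2} √(T−t)`
  set L : ℝ := c * ν ^ (3 / 2 : ℝ) * Real.sqrt (T - t) with hL_def
  have hν32 : 0 < ν ^ (3 / 2 : ℝ) := Real.rpow_pos_of_pos hν _
  have hsqrt : 0 < Real.sqrt (T - t) := Real.sqrt_pos.mpr hTt
  have hL0 : 0 ≤ L := by positivity
  -- pointwise: on `(t,T)` Leray's floor is at least the constant `c ν^{3/2} (√(T−t))⁻¹`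
  have hpt : ∀ s ∈ Ioo t T,
      ENNReal.ofReal (c * ν ^ (3 / 2 : ℝ) * (Real.sqrt (T - t))⁻¹) ≤ F s := by
    intro s hs
    have hs' : s ∈ Ico 0 T := ⟨ht.1.trans hs.1.le, hs.2⟩
    have hTs : 0 < T - s := sub_pos.mpr hs.2
    refine le_trans (ENNReal.ofReal_le_ofReal ?_) (hfl s hs')
    have hrw : (T - s) ^ (-(1 / 2 : ℝ)) = (Real.sqrt (T - s))⁻¹ := by
      rw [Real.rpow_neg hTs.le, ← Real.sqrt_eq_rpow]
    rw [hrw]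
    have hss : Real.sqrt (T - s) ≤ Real.sqrt (T - t) :=
      Real.sqrt_le_sqrt (by linarith [hs.1])
    have hspos : 0 < Real.sqrt (T - s) := Real.sqrt_pos.mpr hTs
    exact mul_le_mul_of_nonneg_left ((inv_le_inv₀ hsqrt hspos).mpr hss) (by positivity)
  have hX : ENNReal.ofReal L ≤ ∫⁻ s in Ioo t T, F s := by
    have hconst : ∫⁻ _ in Ioo t T, ENNReal.ofReal (c * ν ^ (3 / 2 : ℝ) * (Real.sqrt (T - t))⁻¹)
        = ENNReal.ofReal L := by
      rw [setLIntegral_const, Real.volume_Ioo, ← ENNReal.ofReal_mul (by positivity)]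
      congr 1
      rw [hL_def]
      have hne : Real.sqrt (T - t) ≠ 0 := hsqrt.ne'
      have hmul : Real.sqrt (T - t) * Real.sqrt (T - t) = T - t := Real.mul_self_sqrt hTt.le
      field_simp
      nlinarith [hmul]
    rw [← hconst]
    exact setLIntegral_mono' measurableSet_Ioo fun s hs => hpt s hs
  have hXreal : L ≤ (∫⁻ s in Ioo t T, F s).toReal :=
    (ENNReal.ofReal_le_iff_le_toReal hfin).mp hX
  have hKE : VectorCalculus.kineticEnergy (u t) - VectorCalculus.kineticEnergy (u T) =
      ((∫ x, ‖u t x‖ ^ 2) - ∫ x, ‖u T x‖ ^ 2) / 2 := by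
    simp only [VectorCalculus.kineticEnergy]; ring
  rw [hKE] at hdis
  have h1 : ν * L ≤ ((∫ x, ‖u t x‖ ^ 2) - ∫ x, ‖u T x‖ ^ 2) / 2 :=
    (mul_le_mul_of_nonneg_left hXreal hν.le).trans hdis
  have hν52 : ν ^ (5 / 2 : ℝ) = ν * ν ^ (3 / 2 : ℝ) := by
    rw [show (5 / 2 : ℝ) = 1 + 3 / 2 by norm_num, Real.rpow_add hν, Real.rpow_one]
  rw [hν52]
  have h2 : 2 * c * (ν * ν ^ (3 / 2 : ℝ)) * Real.sqrt (T - t) = 2 * (ν * L) := by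
    rw [hL_def]; ring
  rw [h2]
  linarith

/-- **The energy exponent is capped at `1/2`**: near a first blow-up time no energy law
`‖u(t)‖₂² − ‖u(T)‖₂² ≤ C(T−t)^a` with `a > 1/2` can hold (it would undercut Leray's floor
`c ν^{5/2} √(T−t)`). So the ½-Hölder sub-cell `halfHolderClockCell` of Uᶜ is the cell of LERAY-SHARP
dissipation. [folklore] -/
theorem no_energyLaw_above_half :
    ∀ (ν T : ℝ), 0 < ν → 0 < T →
    ∀ (u : ℝ → EuclideanSpace ℝ (Fin 3) → EuclideanSpace ℝ (Fin 3))
      (p : ℝ → EuclideanSpace ℝ (Fin 3) → ℝ),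
      Literature.Analysis.FluidPDE.IsMaximalSmoothSolution ν 0 u p T →
      Literature.Analysis.FluidPDE.IsLerayHopfOn T ν 0 (u 0) u →
      Literature.Analysis.FluidPDE.HasRapidSpatialDecay (u 0) →
      ∀ a : ℝ, 1 / 2 < a →
        ¬ (∃ C T₂ : ℝ, T₂ < T ∧ ∀ t ∈ Set.Ioo T₂ T,
          (∫ x, ‖u t x‖ ^ 2) - ∫ x, ‖u T x‖ ^ 2 ≤ C * (T - t) ^ a) := by
  intro ν T hν hT u p hmax hLH hdec a ha
  rintro ⟨C, T₂, hT₂, hC⟩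
  obtain ⟨c, hc, hfloor⟩ := energyDrop_ge_leray
  -- the floor constant and a positive majorant of `C`
  set c₀ : ℝ := c * ν ^ (5 / 2 : ℝ) with hc₀_def
  have hc₀ : 0 < c₀ := by positivity
  set C' : ℝ := max C 1 with hC'_def
  have hC'pos : 0 < C' := lt_of_lt_of_le one_pos (le_max_right _ _)
  have hCC' : C ≤ C' := le_max_left _ _
  -- the exponent gap
  set ε : ℝ := a - 1 / 2 with hε_def
  have hε : 0 < ε := by rw [hε_def]; linarith
  -- a scale `δ₀` with `C' δ₀^ε = c₀/2`
  set δ₀ : ℝ := (c₀ / (2 * C')) ^ (1 / ε) with hδ₀_def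
  have hq : 0 < c₀ / (2 * C') := by positivity
  have hδ₀ : 0 < δ₀ := Real.rpow_pos_of_pos hq _
  have hδ₀ε : δ₀ ^ ε = c₀ / (2 * C') := by
    rw [hδ₀_def, ← Real.rpow_mul hq.le, one_div_mul_cancel hε.ne', Real.rpow_one]
  -- the time `t = T − δ`
  set δ : ℝ := min δ₀ (min ((T - T₂) / 2) (T / 2)) with hδ_def
  have hδpos : 0 < δ := lt_min hδ₀ (lt_min (by linarith) (by linarith))
  have hδδ₀ : δ ≤ δ₀ := min_le_left _ _
  have hδT₂ : δ ≤ (T - T₂) / 2 := (min_le_right _ _).trans (min_le_left _ _)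
  have hδT : δ ≤ T / 2 := (min_le_right _ _).trans (min_le_right _ _)
  set t : ℝ := T - δ with ht_def
  have htIoo : t ∈ Ioo T₂ T := ⟨by rw [ht_def]; linarith, by rw [ht_def]; linarith⟩
  have htIco : t ∈ Ico 0 T := ⟨by rw [ht_def]; linarith, htIoo.2⟩
  have hTt : T - t = δ := by rw [ht_def]; ring
  have hlow := hfloor ν T hν hT u p hmax hLH hdec t htIco
  have hup := hC t htIoo
  rw [hTt] at hlow hup
  -- `C δ^a ≤ C' δ^ε √δ ≤ (c₀/2) √δ < c₀ √δ`
  have hδa : δ ^ a = δ ^ ε * Real.sqrt δ := by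
    rw [show a = ε + 1 / 2 by rw [hε_def]; ring, Real.rpow_add hδpos, Real.sqrt_eq_rpow]
  have hδε : δ ^ ε ≤ c₀ / (2 * C') := by
    rw [← hδ₀ε]; exact Real.rpow_le_rpow hδpos.le hδδ₀ hε.le
  have hsq : 0 < Real.sqrt δ := Real.sqrt_pos.mpr hδpos
  have hchain : C * δ ^ a ≤ c₀ / 2 * Real.sqrt δ := by
    calc C * δ ^ a ≤ C' * δ ^ a :=
          mul_le_mul_of_nonneg_right hCC' (Real.rpow_nonneg hδpos.le a)
      _ = C' * δ ^ ε * Real.sqrt δ := by rw [hδa]; ring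
      _ ≤ C' * (c₀ / (2 * C')) * Real.sqrt δ :=
          mul_le_mul_of_nonneg_right (mul_le_mul_of_nonneg_left hδε hC'pos.le) hsq.le
      _ = c₀ / 2 * Real.sqrt δ := by field_simp
  have hc₀sq : 0 < c₀ * Real.sqrt δ := mul_pos hc₀ hsq
  rw [hc₀_def] at hc₀sq hchain
  linarith

/-- **Clock floor (Leray)**: at a first blow-up time the `L²`-trajectory cannot reach `u(T)` faster
than linearly — `∫|u(t)−u(T)|² ≥ c ν⁵ (T−t)/‖u₀‖₂²` for all `t ∈ [0,T)` (one universal `c > 0`):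
the energy floor squared under the landed modulus bound (S)
`‖u(t)‖₂² − ‖u(T)‖₂² ≤ 2‖u₀‖₂ (∫|u(t)−u(T)|²)^{1/2}`. (For the zero datum the right side is the junk
value `0` and there is no blow-up anyway.) [folklore] -/
theorem clock_ge_leray :
    ∃ c : ℝ, 0 < c ∧ ∀ (ν T : ℝ), 0 < ν → 0 < T →
    ∀ (u : ℝ → EuclideanSpace ℝ (Fin 3) → EuclideanSpace ℝ (Fin 3))
      (p : ℝ → EuclideanSpace ℝ (Fin 3) → ℝ),
      Literature.Analysis.FluidPDE.IsMaximalSmoothSolution ν 0 u p T →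
      Literature.Analysis.FluidPDE.IsLerayHopfOn T ν 0 (u 0) u →
      Literature.Analysis.FluidPDE.HasRapidSpatialDecay (u 0) →
      ∀ t ∈ Set.Ico 0 T,
        ENNReal.ofReal (c * ν ^ (5 : ℝ) * (T - t) / ∫ x, ‖u 0 x‖ ^ 2) ≤
          ∫⁻ x, ‖u t x - u T x‖ₑ ^ 2 := by
  obtain ⟨c, hc, hfloor⟩ := energyDrop_ge_leray
  refine ⟨c ^ 2 / 4, by positivity, ?_⟩
  intro ν T hν hT u p hmax hLH hdec t ht
  have hcl : IsClassicalNSSolutionOn (Ico 0 T) ν 0 u p := hmax.1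
  have hT' : T ∈ Icc 0 T := ⟨hT.le, le_rfl⟩
  have hmt : MemLp (u t) 2 volume := hLH.memLp t ⟨ht.1, ht.2.le⟩
  have hmT : MemLp (u T) 2 volume := hLH.memLp T hT'
  -- the clock quantity is a genuine real number
  set H : ℝ := ∫ x, ‖u t x - u T x‖ ^ 2 with hH_def
  have hH0 : 0 ≤ H := integral_nonneg fun _ => sq_nonneg _
  have hη : ∫⁻ x, ‖u t x - u T x‖ₑ ^ 2 = ENNReal.ofReal H := by
    have h := GeneralWindowTradeoff.EnergyDrop.lintegral_enorm_sq_eq_ofReal_integral (u t - u T)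
      (hmt.sub hmT)
    simpa only [Pi.sub_apply] using h
  rw [hη]
  refine ENNReal.ofReal_le_ofReal ?_
  set E₀ : ℝ := ∫ x, ‖u 0 x‖ ^ 2 with hE₀_def
  have hE₀0 : 0 ≤ E₀ := integral_nonneg fun _ => sq_nonneg _
  have hTt : 0 < T - t := sub_pos.mpr ht.2
  -- energy floor and modulus bound (S)
  have hlow := hfloor ν T hν hT u p hmax hLH hdec t ht
  have hup := GeneralWindowTradeoff.stub_energyDrop_le_modulus ν T hν hT u p hcl hLH hdec t
    ⟨ht.1, ht.2.le⟩ H hH0 (le_of_eq hη)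
  -- `c ν^{5/2} √(T−t) ≤ 2 √E₀ √H`; square it
  have hA0 : 0 ≤ c * ν ^ (5 / 2 : ℝ) * Real.sqrt (T - t) := by positivity
  have hAB : c * ν ^ (5 / 2 : ℝ) * Real.sqrt (T - t) ≤ 2 * Real.sqrt E₀ * Real.sqrt H :=
    hlow.trans hup
  have hsqle : (c * ν ^ (5 / 2 : ℝ) * Real.sqrt (T - t)) ^ 2 ≤ (2 * Real.sqrt E₀ * Real.sqrt H) ^ 2 :=
    pow_le_pow_left₀ hA0 hAB 2
  have hlhs : (c * ν ^ (5 / 2 : ℝ) * Real.sqrt (T - t)) ^ 2 = c ^ 2 * ν ^ (5 : ℝ) * (T - t) := by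
    have hν5 : (ν ^ (5 / 2 : ℝ)) ^ 2 = ν ^ (5 : ℝ) := by
      rw [sq, ← Real.rpow_add hν]; norm_num
    rw [mul_pow, mul_pow, Real.sq_sqrt hTt.le, hν5]
  have hrhs : (2 * Real.sqrt E₀ * Real.sqrt H) ^ 2 = 4 * E₀ * H := by
    rw [mul_pow, mul_pow, Real.sq_sqrt hE₀0, Real.sq_sqrt hH0]; norm_num
  rw [hlhs, hrhs] at hsqle
  by_cases hE : E₀ = 0
  · -- zero datum: the claimed floor is the junk value `0`
    rw [hE, div_zero]; exact hH0
  · have hE₀pos : 0 < E₀ := lt_of_le_of_ne hE₀0 (Ne.symm hE)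
    rw [div_le_iff₀ hE₀pos]
    nlinarith [hsqle]

/-- **The clock exponent is capped at `1`**: at a first blow-up no clock `∫|u(t)−u(T)|² ≤ K(T−t)^b`
with `b > 1` can hold — by the free energy exponent `a = b/2 > 1/2` (`energyLaw_of_clock`) and the
energy cap `no_energyLaw_above_half`. With `energyLaw_of_clock` and `energyDrop_ge_leray` this pins
the admissible exponent rectangle `b ∈ (0,1]`, `a ∈ [b/2, 1/2]`. [folklore] -/
theorem no_clock_above_one :
    ∀ (ν T : ℝ), 0 < ν → 0 < T →
    ∀ (u : ℝ → EuclideanSpace ℝ (Fin 3) → EuclideanSpace ℝ (Fin 3))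
      (p : ℝ → EuclideanSpace ℝ (Fin 3) → ℝ),
      Literature.Analysis.FluidPDE.IsMaximalSmoothSolution ν 0 u p T →
      Literature.Analysis.FluidPDE.IsLerayHopfOn T ν 0 (u 0) u →
      Literature.Analysis.FluidPDE.HasRapidSpatialDecay (u 0) →
      ∀ b : ℝ, 1 < b →
        ¬ (∃ K T₁ : ℝ, T₁ < T ∧ ∀ t ∈ Set.Ioo T₁ T,
          ∫⁻ x, ‖u t x - u T x‖ₑ ^ 2 ≤ ENNReal.ofReal (K * (T - t) ^ b)) := by
  intro ν T hν hT u p hmax hLH hdec b hb hclock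
  have henergy := energyLaw_of_clock ν T hν hT u p hmax.1 hLH hdec hclock
  exact no_energyLaw_above_half ν T hν hT u p hmax hLH hdec (b / 2) (by linarith) henergy

end EnergyClockScarLaw

end Summit.NavierStokesRegularity.NavierStokesRegularity.Theorems
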